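import Summits.ABC.IUTFork.Charitable.Thm311D1PerPlaceFineKit
import HarnessLib

/-!
# Branch D, team D1 — the per-place square does NOT give S once the region operator resolves vectors (item (δ′) of the referee's sheet)

Record file (D-0012; abc-iut cell, rung LADDER-ABC:A2.D; abc-iut-D1-prv gen 2; plan/D-ref/GRADE.md §(ii) «separating model (per-place ∧ pins
∧ ¬S) … OPEN, holders D1-prv g2»). TAKES NO SIDE on [IUTchIII] Cor. 3.12 or on any author; NO `Prop` fact; no new definition — model data
from `Thm311D1PerPlaceSeparation` (`idSetting`), `…SeparationSub` (`sepDatumSub`) and Kit III (`fineRegion`); everything here is a theorem.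

WHAT IS DECIDED HERE. S := `Cor312Vol.PilotKummerIndRelated S P ρ qK` depends on the region-forming operator `ρ` (and on the setting only
through its column `n`). At the operators of record (sign-blind cylinders) the per-place square gives S (p431983). At Kit III's
VECTOR-RESOLVING operator `fineRegion` — LOCAL over `v_ℚ` and (hρ)-EQUIVARIANT under ⟨(Ind1)∪(Ind2)⟩, i.e. a legitimate binder for PR-1's `ρ`
as far as the Θ-pin's first conjunct goes — the per-place square does NOT give S: `sepDatumSub_not_S_fine`. Certificate `perPlace_not_S_fine`:
over ANY index skeleton with two distinct bad places `v ≠ v′` over one rational place, at (sign shells, `NaiveProv.full1`, `idSetting`,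
`fineRegion`, the sub-packet q-datum `sepDatumSub` of p438449): sub-packet placement ∧ PER-PLACE square ∧ Thm. 3.11 (ii)(b) ∧ (hρ) ∧ locality
HOLD and **S FAILS**; closed instance `perPlace_not_S_fine_instance`. Mechanism: S at the packet `(l⋆, v_ℚ(v))` would make the
coordinate-classes of the data of `v` and `v′` those of ONE transported datum `Φ·Ψ`; coordinate support pins the transporting place
(`place_eq_of_coordClass`: a class with a nonzero coordinate «all factors at `b`» can only come from the place `b`), and then Kit III's
`sign_ratio'` twice gives `e₀(v) = e₀(v′)` and `e₀(v′) = −e₀(v)` for `Φ`'s separable sign — contradiction.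
WHAT IS NOT DECIDED (honest scope): the Θ-pin's second conjunct and the q-pin for `fineRegion` would need a Cor. 3.12 setting whose pilot
REGIONS are such finite vector classes (hull frame, admissibility and log-volumes for them); no such setting exists in the tree and none is
built here — so «per-place ∧ THREE PINS ∧ ¬S» stays unexhibited; what is exhibited is «per-place ∧ (ii)(b) ∧ equivariant local operator ∧ ¬S»,
and, with the pins, «per-place ∧ pins ∧ S ∧ ¬uniform» (p435474/p438449). READING: S's strength is operator-relative; for vector-resolving
operators S coincides packetwise with the uniform square's content, which the per-place square lacks; grades unchanged (both readings are
datum-level, above Rmk. 3.11.4 (i), S. Mochizuki, *Inter-universal Teichmüller theory III*, kurims (May 2020) p. 172 l. 34–41).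
[claim: Mochizuki2012, status: disputed] [cite: ScholzeStix2018, §2.2 pp. 9–10] Standard axioms; typed ≠ proved.
-/

noncomputable section

open Set

namespace Summit.ABC.IUTFork.Charitable

open Thm311 Cor312 Cor312Vol Literature.IUT.LogThetaLattice

variable {T : ThetaIndex} (p : ℕ) [hp : Fact p.Prime]

/-! ## 1. Coordinate support pins the place of a coordinate class -/

omit hp in
open scoped Classical in
/-- The one-factor theta vector of `u` read along any tuple: `q^{j²}` iff the `α = j` factor is read at the place `u` (place form of Kit I's
`coordTuple_thetaVec1`). [folklore] -/
theorem coordTuple_thetaVec1_val (u : T.V) (j : T.Label) (w : T.Caps j → T.Fibre (T.over u)) :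
    coordTuple j (T.over u) w (NaiveProv.thetaVec1 p u j) = if (w (T.selfIndex j)).1 = u then (p : ℚ) ^ ((j : ℕ) ^ 2) else 0 := by
  have h := coordTuple_rebase_thetaVec1 p (rfl : T.over u = T.over u) j w
  rwa [rebase_self] at h

omit hp in
/-- **Coordinate support pins the place**: if a vector `t` of the packet `(j, v_ℚ)` has the (rebased) tuple coordinates of `Φ·f_j` for an
element `f` of the splitting monoid of the place `u₁ ∣ v_ℚ` and `Φ ∈ ⟨(Ind1)∪(Ind2)⟩`, and `t` has a NONZERO coordinate «all factors at `b`»,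
then `b` IS the place `u₁` (the `α = j` factor of `θ_{u₁,j}` vanishes off the summand `u₁`, and `Φ` only permutes factors and multiplies by
signs). [folklore] -/
theorem place_eq_of_coordClass {Φ : (NaiveProv.signShells T).PacketAut}
    (hΦ : Φ ∈ Subgroup.closure ((NaiveProv.signShells T).Ind1Family ∪ (NaiveProv.signShells T).Ind2Family))
    {u₁ : T.V} {vQ : T.VQ} (hu₁ : T.over u₁ = vQ) (j : T.LabelStar)
    {f : (NaiveProv.signShells T).StarPacket u₁} (hf : f ∈ NaiveProv.PsiOf (NaiveProv.thetaVec1 p) u₁)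
    {t : (NaiveProv.signShells T).Packet j.1 vQ}
    (hc : ∀ w : T.Caps j.1 → T.Fibre vQ,
      coordTuple j.1 vQ w t = coordTuple j.1 (T.over u₁) (rebase hu₁ w) (Φ j.1 (T.over u₁) (f j)))
    (b : T.Fibre vQ) (hb : coordTuple j.1 vQ (fun _ => b) t ≠ 0) : b.1 = u₁ := by
  by_contra hne
  obtain ⟨τ, e, -, hτe⟩ := sepSignedAt_of_mem_closure hΦ j.1 (T.over u₁)
  obtain ⟨s, -, hfj⟩ := exists_smul_of_mem_PsiOf p hf j
  have A := hc (fun _ => b)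
  rw [hτe, hfj, map_smul, smul_eq_mul, coordTuple_thetaVec1] at A
  have hcond : ¬ ((fun i => rebase hu₁ (fun _ : T.Caps j.1 => b) (τ i)) (T.selfIndex j.1) = T.toFibre u₁) :=
    fun h => hne (congrArg Subtype.val h)
  rw [if_neg hcond, mul_zero, mul_zero] at A
  exact hb A

/-! ## 2. S FAILS for the sub-packet per-place datum at the vector-resolving operator -/

/-- **`¬S` at `fineRegion`** for the sub-packet per-place datum `sepDatumSub` (p438449) — two distinct bad places over one rational place.
[folklore] -/
theorem sepDatumSub_not_S_fine (c : ℝ) {v v' : T.V} (hv : v ∈ T.Vbad) (hv' : v' ∈ T.Vbad) (hne : v ≠ v')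
    (hover : T.over v' = T.over v) :
    ¬ PilotKummerIndRelated (NaiveProv.full1 p (T.over v) c).toLatticeSituation (idSetting p v hv c) fineRegion
      (sepDatumSub p v v') := by
  classical
  intro hS
  have hself := selfIndex_labelLast_ne_zero T
  have hP : (p : ℚ) ^ (((labelLast T).1 : ℕ) ^ 2) ≠ 0 := pow_ne_zero _ (Nat.cast_ne_zero.mpr hp.out.ne_zero)
  obtain ⟨D', hD', hEq⟩ := hS (labelLast T).1 (T.over v)
  obtain ⟨Φ, hΦ, hΦΨ⟩ := GluedMonoids.exists_closure_psi_eq_of_mem_RLGP (L := NaiveProv.signShells T) hD'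
  have hΨ' : D'.Ψ = fun w hw => (NaiveProv.signShells T).starAut Φ w '' NaiveProv.PsiOf (NaiveProv.thetaVec1 p) w :=
    funext fun w => funext fun hw => by rw [hΦΨ w hw]; rfl
  rw [hΨ'] at hEq
  -- (M1) the flipped theta vector of `v` lies in the q-side class
  have hM1 : negSummandFamily v' (labelLast T).1 (T.over v) (NaiveProv.thetaVec1 p v (labelLast T).1) ∈
      fineRegion (sepDatumSub p v v') (labelLast T).1 (T.over v) := by
    rw [mem_fineRegion_iff (labelLast T).2]
    refine ⟨v, hv, rfl, (NaiveProv.signShells T).starAut (negSummandFamily v') v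
      (NaiveProv.thetaTupleOf (NaiveProv.thetaVec1 p) v), ?_, fun w => ?_⟩
    · show _ ∈ sepDatumSub p v v' v hv
      unfold sepDatumSub
      rw [if_pos rfl]
      exact ⟨_, NaiveProv.thetaTupleOf_mem_PsiOf _ v, rfl⟩
    · rw [rebase_self]
      simp [LogShells.starAut, NaiveProv.thetaTupleOf]
  -- (M2) the ghost of the theta vector of `v′` lies in the q-side class
  have hM2 : ghostTheta p v' (T.over v) (labelLast T).1 ∈ fineRegion (sepDatumSub p v v') (labelLast T).1 (T.over v) := by
    rw [mem_fineRegion_iff (labelLast T).2]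
    refine ⟨v', hv', hover, NaiveProv.thetaTupleOf (NaiveProv.thetaVec1 p) v', ?_, fun w => ?_⟩
    · show _ ∈ sepDatumSub p v v' v' hv'
      unfold sepDatumSub
      rw [if_neg (Ne.symm hne)]
      exact NaiveProv.thetaTupleOf_mem_PsiOf _ v'
    · rw [coordTuple_ghostTheta]
      show _ = coordTuple (labelLast T).1 (T.over v') (rebase hover w) (NaiveProv.thetaVec1 p v' (labelLast T).1)
      rw [coordTuple_rebase_thetaVec1]
  rw [hEq, mem_fineRegion_iff (labelLast T).2] at hM1 hM2
  obtain ⟨v₁, hv₁, hvQ₁, ψ₁, ⟨f, hf, rfl⟩, hc1⟩ := hM1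
  obtain ⟨v₂, hv₂, hvQ₂, ψ₂, ⟨f', hf', rfl⟩, hc2⟩ := hM2
  have hcomp : ∀ (u : T.V) (g : (NaiveProv.signShells T).StarPacket u),
      ((NaiveProv.signShells T).starAut Φ u g) ⟨(labelLast T).1, (labelLast T).2⟩ =
        Φ (labelLast T).1 (T.over u) (g ⟨(labelLast T).1, (labelLast T).2⟩) :=
    fun u g => by simp [LogShells.starAut]
  simp only [hcomp] at hc1 hc2
  -- the transporting places are forced: `v₁ = v`, `v₂ = v′`
  have e1 := place_eq_of_coordClass p hΦ hvQ₁ (labelLast T) hf hc1 (T.toFibre v) (by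
    rw [coordTuple_neg_thetaVec1_const p v' v hne (labelLast T)]
    exact mul_ne_zero one_ne_zero hP)
  have e2 := place_eq_of_coordClass p hΦ hvQ₂ (labelLast T) hf' hc2 ⟨v', hover⟩ (by
    rw [coordTuple_ghostTheta, if_pos rfl]
    exact hP)
  have e1' : v₁ = v := e1.symm
  have e2' : v₂ = v' := e2.symm
  subst e1' e2'
  -- ONE separable sign for `Φ` at the label `l⋆` in the packet at `v_ℚ(v)`; transport to `v_ℚ(v′)`
  obtain ⟨τ, e, he, hτe⟩ := sepSignedAt_of_mem_closure hΦ (labelLast T).1 (T.over v₁)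
  have hτe' : ∀ (w : T.Caps (labelLast T).1 → T.Fibre (T.over v₂)) t,
      coordTuple (labelLast T).1 (T.over v₂) w (Φ (labelLast T).1 (T.over v₂) t) =
        (∏ i, e i (w i).1) * coordTuple (labelLast T).1 (T.over v₂) (fun i => w (τ i)) t := by
    rw [hvQ₂]; exact hτe
  have hz₁ : (⟨v₁, hvQ₂.symm⟩ : T.Fibre (T.over v₂)) ≠ T.toFibre v₂ := fun h => hne (congrArg Subtype.val h)
  have hz₂ : (⟨v₂, hvQ₂⟩ : T.Fibre (T.over v₁)) ≠ T.toFibre v₁ := fun h => hne (congrArg Subtype.val h).symm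
  -- `v`-side: `Φ` realises the flip on `Ψ_v` (coordinatewise)
  have ht : ∀ w : T.Caps (labelLast T).1 → T.Fibre (T.over v₁),
      coordTuple (labelLast T).1 (T.over v₁) w (Φ (labelLast T).1 (T.over v₁) (f (labelLast T))) =
        coordTuple (labelLast T).1 (T.over v₁) w
          (negSummandFamily v₂ (labelLast T).1 (T.over v₁) (NaiveProv.thetaVec1 p v₁ (labelLast T).1)) := fun w => by
    have h := hc1 w
    rw [rebase_self] at h
    exact h.symm
  have hcb := coordTuple_neg_thetaVec1_tuple0 p v₂ v₁ ⟨v₂, hvQ₂⟩ rfl (labelLast T) hself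
  have hca := coordTuple_neg_thetaVec1_const p v₂ v₁ hne (labelLast T)
  have hii := sign_ratio' p ⟨v₂, hvQ₂⟩ hz₂ (labelLast T) hτe hf ht (by norm_num) hcb hca
  -- `v′`-side: `Φ` fixes `Ψ_{v′}` (coordinatewise)
  have ht' : ∀ w : T.Caps (labelLast T).1 → T.Fibre (T.over v₂),
      coordTuple (labelLast T).1 (T.over v₂) w (Φ (labelLast T).1 (T.over v₂) (f' (labelLast T))) =
        coordTuple (labelLast T).1 (T.over v₂) w (NaiveProv.thetaVec1 p v₂ (labelLast T).1) := fun w => by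
    have h := hc2 (rebase hvQ₂.symm w)
    rw [rebase_rebase, coordTuple_ghostTheta] at h
    have h' : coordTuple (labelLast T).1 (T.over v₂) w (Φ (labelLast T).1 (T.over v₂) (f' (labelLast T))) =
        (if ((rebase hvQ₂.symm w) (T.selfIndex (labelLast T).1)).1 = v₂ then (p : ℚ) ^ (((labelLast T).1 : ℕ) ^ 2) else 0) :=
      h.symm
    rw [h', coordTuple_thetaVec1_val, rebase_val]
  have hcb' : coordTuple (labelLast T).1 (T.over v₂)
      (fun i => if i = 0 then (⟨v₁, hvQ₂.symm⟩ : T.Fibre (T.over v₂)) else T.toFibre v₂)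
      (NaiveProv.thetaVec1 p v₂ (labelLast T).1) = 1 * (p : ℚ) ^ (((labelLast T).1 : ℕ) ^ 2) := by
    rw [one_mul]; exact coordTuple_thetaVec1_tuple0 p v₂ _ (labelLast T) hself
  have hca' : coordTuple (labelLast T).1 (T.over v₂) (fun _ => T.toFibre v₂)
      (NaiveProv.thetaVec1 p v₂ (labelLast T).1) = 1 * (p : ℚ) ^ (((labelLast T).1 : ℕ) ^ 2) := by
    rw [coordTuple_thetaVec1, if_pos rfl, one_mul]
  have hi := sign_ratio' p ⟨v₁, hvQ₂.symm⟩ hz₁ (labelLast T) hτe' hf' ht' one_ne_zero hcb' hca'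
  -- combine
  simp only [mul_one, mul_neg] at hi hii
  have hev := he 0 v₁
  have h0 : e 0 v₁ = 0 := by linarith
  rw [h0, abs_zero] at hev
  exact zero_ne_one hev

/-- **CERTIFICATE (δ′).** Over ANY index skeleton with two distinct bad places over one rational place, at (sign shells, `NaiveProv.full1`,
`idSetting`, the vector-resolving operator `fineRegion`, the sub-packet q-datum `sepDatumSub`): the datum lies in the sub-packets, the
PER-PLACE square and Thm. 3.11 (ii)(b) hold, the operator is (hρ)-EQUIVARIANT and LOCAL — and S FAILS. (The Θ/q-PINS for this operator are
NOT exhibited: they need a setting with finite-vector pilot regions, not built.) [claim: Mochizuki2012, status: disputed] -/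
theorem perPlace_not_S_fine (c : ℝ) {v v' : T.V} (hv : v ∈ T.Vbad) (hv' : v' ∈ T.Vbad) (hne : v ≠ v')
    (hover : T.over v' = T.over v) :
    (∀ (w : T.V) (hw : w ∈ T.Vbad), ∀ f ∈ sepDatumSub p v v' w hw, ∀ j : T.LabelStar,
        f j ∈ (NaiveProv.signShells T).SubPacket j.1 w) ∧
    PerPlaceKummerCompat (NaiveProv.full1 p (T.over v) c).toLatticeSituation (idSetting p v hv c) (sepDatumSub p v v') ∧
    ((NaiveProv.full1 p (T.over v) c).toLatticeSituation.col (idSetting p v hv c).n).KummerB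
      ((NaiveProv.full1 p (T.over v) c).toLatticeSituation.D (idSetting p v hv c).n) ∧
    (∀ Φ ∈ Subgroup.closure ((NaiveProv.signShells T).Ind1Family ∪ (NaiveProv.signShells T).Ind2Family),
      ∀ (Ψ : ∀ w : T.V, w ∈ T.Vbad → Set ((NaiveProv.signShells T).StarPacket w)) (j : T.Label) (vQ : T.VQ),
        fineRegion (fun w hw => (NaiveProv.signShells T).starAut Φ w '' Ψ w hw) j vQ = Φ j vQ '' fineRegion Ψ j vQ) ∧
    LocalOverVQ (NaiveProv.full1 p (T.over v) c).toLatticeSituation fineRegion ∧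
    ¬ PilotKummerIndRelated (NaiveProv.full1 p (T.over v) c).toLatticeSituation (idSetting p v hv c) fineRegion
      (sepDatumSub p v v') :=
  ⟨fun w hw _ hf j => sepDatumSub_subPacket p v v' w hw hf j, sepDatumSub_perPlace p v v' hv c,
    GluedMonoids.kummerB_of_statement (NaiveProv.full1 p (T.over v) c) (NaiveProv.full1_statement p (T.over v) c) _,
    fun _ hΦ Ψ j vQ => fineRegion_equivariant hΦ Ψ j vQ, fineRegion_local p (T.over v) c,
    sepDatumSub_not_S_fine p c hv hv' hne hover⟩

/-- **Closed instance of (δ′)** at `twoBadIndex` (`q = 2`, `c = 1`): sub-packet datum, per-place square, (ii)(b), an equivariant local operator,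
and `¬S`. [claim: Mochizuki2012, status: disputed] -/
theorem perPlace_not_S_fine_instance :
    ∃ (T : ThetaIndex) (S : LatticeSituation T) (P : Cor312.Setting S.toSituation)
      (ρ : (∀ v : T.V, v ∈ T.Vbad → Set (S.L.StarPacket v)) → ∀ (j : T.Label) (vQ : T.VQ), Set (S.L.Packet j vQ))
      (qK : ∀ v : T.V, v ∈ T.Vbad → Set (S.L.StarPacket v)),
      PerPlaceKummerCompat S P qK ∧ (S.col P.n).KummerB (S.D P.n) ∧
      (∀ Φ ∈ Subgroup.closure (S.L.Ind1Family ∪ S.L.Ind2Family),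
        ∀ (Ψ : ∀ w : T.V, w ∈ T.Vbad → Set (S.L.StarPacket w)) (j : T.Label) (vQ : T.VQ),
          ρ (fun w hw => S.L.starAut Φ w '' Ψ w hw) j vQ = Φ j vQ '' ρ Ψ j vQ) ∧
      LocalOverVQ S ρ ∧ ¬ PilotKummerIndRelated S P ρ qK := by
  haveI : Fact (Nat.Prime 2) := ⟨Nat.prime_two⟩
  obtain ⟨-, h1, h2, h3, h4, h5⟩ := perPlace_not_S_fine (T := twoBadIndex) 2 1 (v := true) (v' := false) trivial trivial
    (show (true : Bool) ≠ false by decide) rfl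
  exact ⟨twoBadIndex, (NaiveProv.full1 2 (twoBadIndex.over true) 1).toLatticeSituation,
    idSetting (T := twoBadIndex) 2 true trivial 1, fineRegion, sepDatumSub (T := twoBadIndex) 2 true false, h1, h2, h3, h4, h5⟩

end Summit.ABC.IUTFork.Charitable

end
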